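import Literature.Geometry.Riemannian.RicciFlowSpatialRicciBounds
import Literature.Geometry.Riemannian.RicciFlowChartRmCovariantNorms
import Mathlib.Analysis.SpecialFunctions.Log.Deriv
import HarnessLib

/-!
# Logarithmic a priori bounds for the Christoffel symbols of a Type-I Ricci flow in a chart
(helper file 6 for stub `stub_smoothRoundLimit`, line `margerin-cone-hamilton-rails`, crux
`EntropyRung.ChangGurskyYang`, item stmt-SmoothPoincare4-10834)

Pure coordinate calculus (`MetricCoord`): a smooth family of metric components `G_t` on `V`
solving the coordinate Ricci flow `∂ₜG = −2 Ric(G)` on `[t₀, T)`, with, on a compact `K ⊆ V`,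
the SCALED bounds `|g^{ac}| ≤ C_g/(T−t)` (the inverse of `G/(T−t)` is bounded) and bounded
components of `∇Ric`, `∇²Ric` (scale invariant; from the scaled Shi bounds). Then the Christoffel
symbols and their first coordinate derivatives grow at most LOGARITHMICALLY as `t ↑ T`:

* `abs_le_of_deriv_boundary` — comparison with a boundary function: `|f'| ≤ B'` on `[t₁, T)` gives
  `|f(t)| ≤ |f(t₁)| + B(t) − B(t₁)`;
* `abs_chrCoef_le_log` — `|Γ(y, t)| ≤ A₀ (1 + log((T−t₀)/(T−t)))` on `K × [t₀, T)`: by Topping's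
  Prop. 2.3.1, `∂ₜΓ = −g⁻¹ * ∇Ric = O((T−t)⁻¹)`, integrated in time;
* `abs_pd_chrCoef_le_log_sq` — `|∂Γ(y, t)| ≤ A₁ (1 + log((T−t₀)/(T−t)))²`: differentiate
  `∂ₜΓ` in space (`∂g⁻¹ = −g⁻¹Γ − Γg⁻¹`, `∂(∇Ric) = ∇²Ric + Γ∇Ric`), so that
  `∂ₜ∂Γ = O((1 + log)(T−t)⁻¹)`, and integrate again.

These crude bounds are the lower-order input of the interpolation giving the decay of the
covariant Ricci derivatives of the scaled flow (Hamilton 1982, §17: `∇ᵏRic → 0` for the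
normalised flow), which in turn makes `∂ₜΓ` integrable (ibid., §14, Lemma 14.2 ff.).

## References

* R. S. Hamilton, *Three-manifolds with positive Ricci curvature*, J. Differential Geom. 17
  (1982) 255–306, §14, Lemma 14.2 ff.; §17, Thm. 17.6. [Hamilton1982]
* P. Topping, *Lectures on the Ricci flow*, LMS Lecture Note Series 325, CUP 2006, Prop. 2.3.1;
  §5.3, proof of Thm. 5.3.1, pp. 47–48. [Topping2006]
-/

noncomputable section

-- every `Summit.SmoothPoincare4.SmoothPoincare4.…` name repeats the summit = sub-problem segment (D-0017 layout)
set_option linter.dupNamespace false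

-- operator spaces of bilinear forms over the model space
set_option maxSynthPendingDepth 3

open Set Function Filter Real Module Metric
open scoped Topology ContDiff

namespace Summit.SmoothPoincare4.SmoothPoincare4.Theorems.MargerinRails

open Literature.Geometry.Lorentzian Literature.Geometry.Lorentzian.MetricCoord

universe u

/-! ### Comparison with a boundary function on `[t₁, T)` -/

section Comparison

/-- **Comparison with a boundary function**: if `f` has derivative `f'` within `[t₁, T)`,
`|f'(s)| ≤ B'(s)` there, and `B` is continuous on `[t₁, T)` with right derivative `B'`, then
`|f(t)| ≤ |f(t₁)| + (B(t) − B(t₁))` on `[t₁, T)` (Mathlib's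
`image_norm_le_of_norm_deriv_right_le_deriv_boundary'` on `[t₁, t]`). [folklore] -/
theorem abs_le_of_deriv_boundary {f f' B B' : ℝ → ℝ} {t₁ T : ℝ}
    (hf : ∀ s ∈ Ico t₁ T, HasDerivWithinAt f (f' s) (Ico t₁ T) s)
    (hB : ContinuousOn B (Ico t₁ T)) (hB' : ∀ s ∈ Ico t₁ T, HasDerivWithinAt B (B' s) (Ici s) s)
    (hbound : ∀ s ∈ Ico t₁ T, |f' s| ≤ B' s) :
    ∀ t ∈ Ico t₁ T, |f t| ≤ |f t₁| + (B t - B t₁) := by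
  intro t ht
  have hsub : Icc t₁ t ⊆ Ico t₁ T := fun s hs ↦ ⟨hs.1, hs.2.trans_lt ht.2⟩
  have hnhds : ∀ s ∈ Ico t₁ t, Ico t₁ T ∈ 𝓝[≥] s := fun s hs ↦
    mem_of_superset (Ico_mem_nhdsGE (hs.2.trans ht.2)) (Ico_subset_Ico_left hs.1)
  have hcont : ContinuousOn (fun s ↦ f s - f t₁) (Icc t₁ t) := fun s hs ↦
    (((hf s (hsub hs)).continuousWithinAt).mono hsub).sub continuousWithinAt_const
  have hder : ∀ s ∈ Ico t₁ t, HasDerivWithinAt (fun s ↦ f s - f t₁) (f' s) (Ici s) s := fun s hs ↦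
    ((hf s ⟨hs.1, hs.2.trans ht.2⟩).mono_of_mem_nhdsWithin (hnhds s hs)).sub_const _
  have hBc : ContinuousOn (fun s ↦ B s - B t₁) (Icc t₁ t) := (hB.mono hsub).sub continuousOn_const
  have hBd : ∀ s ∈ Ico t₁ t, HasDerivWithinAt (fun s ↦ B s - B t₁) (B' s) (Ici s) s := fun s hs ↦
    (hB' s ⟨hs.1, hs.2.trans ht.2⟩).sub_const _
  have h0 : ‖f t₁ - f t₁‖ ≤ B t₁ - B t₁ := by simp
  have key := image_norm_le_of_norm_deriv_right_le_deriv_boundary' hcont hder h0 hBc hBd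
    (fun s hs ↦ by rw [Real.norm_eq_abs]; exact hbound s ⟨hs.1, hs.2.trans ht.2⟩) ⟨ht.1, le_rfl⟩
  rw [Real.norm_eq_abs] at key
  calc |f t| = |f t₁ + (f t - f t₁)| := by ring_nf
    _ ≤ |f t₁| + |f t - f t₁| := abs_add_le _ _
    _ ≤ |f t₁| + (B t - B t₁) := add_le_add le_rfl key

/-- The logarithmic boundary function `log((T−t₀)/(T−s)) = log(T−t₀) − log(T−s)` has right
derivative `1/(T−s)` at `s < T`. [folklore] -/
theorem hasDerivWithinAt_log_sub {T s : ℝ} (hs : s < T) :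
    HasDerivWithinAt (fun s ↦ -Real.log (T - s)) (1 / (T - s)) (Ici s) s := by
  have hTs : T - s ≠ 0 := (sub_pos.2 hs).ne'
  have h1 : HasDerivAt (fun s : ℝ ↦ T - s) (-1) s := by
    simpa using (hasDerivAt_id s).const_sub T
  have h2 := (h1.log hTs).neg
  have hval : -(-1 / (T - s)) = 1 / (T - s) := by ring
  rw [hval] at h2
  exact h2.hasDerivWithinAt

/-- The squared logarithmic boundary function `(log(T−t₀) − log(T−s))²/2` has right derivative
`(log(T−t₀) − log(T−s))/(T−s)` at `s < T`. [folklore] -/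
theorem hasDerivWithinAt_log_sub_sq {T t₀ s : ℝ} (hs : s < T) :
    HasDerivWithinAt (fun s ↦ (Real.log (T - t₀) - Real.log (T - s)) ^ 2 / 2)
      ((Real.log (T - t₀) - Real.log (T - s)) / (T - s)) (Ici s) s := by
  have h1 : HasDerivWithinAt (fun s ↦ Real.log (T - t₀) - Real.log (T - s)) (1 / (T - s)) (Ici s) s := by
    have := (hasDerivWithinAt_log_sub hs).const_add (Real.log (T - t₀))
    simpa [sub_eq_add_neg] using this
  have h2 := (h1.pow 2).div_const 2
  refine h2.congr_deriv ?_
  simp; ring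

/-- `log((T−t₀)/(T−t)) = log(T−t₀) − log(T−t) ≥ 0` for `t₀ ≤ t < T`. [folklore] -/
theorem log_ratio_eq {T t₀ t : ℝ} (ht : t ∈ Ico t₀ T) :
    Real.log ((T - t₀) / (T - t)) = Real.log (T - t₀) - Real.log (T - t) ∧
      0 ≤ Real.log ((T - t₀) / (T - t)) := by
  have hTt : 0 < T - t := sub_pos.2 ht.2
  have hT₀ : 0 < T - t₀ := lt_of_lt_of_le hTt (by linarith [ht.1])
  refine ⟨Real.log_div hT₀.ne' hTt.ne', Real.log_nonneg ?_⟩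
  rw [le_div_iff₀ hTt]; linarith [ht.1]

end Comparison

/-! ### The inverse of a uniformly positive form -/

section Ginv

variable {E : Type u} [NormedAddCommGroup E] [NormedSpace ℝ E] [FiniteDimensional ℝ E]
  {ι : Type*} [Fintype ι]

omit [Fintype ι] in
/-- **The inverse coefficients of a positive form are controlled by its lower bound**: if
`λ' |v|² ≤ G_x(v,v)` (`λ' > 0`), `G_x` symmetric and invertible, then
`|g^{ac}| ≤ ‖bᵃ‖ ‖bᶜ‖ n/λ'` (`g^{ac} = Σ_k bᵃ(e_k) bᶜ(e_k)` in a `G_x`-orthonormal frame `e`,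
`λ'|e_k|² ≤ 1`; the computation of `pdBddOn_ginvFam_zero`). [cite: ONeill1983, Ch. 3, p. 60] -/
theorem abs_ginv_le_of_lower (b : Basis ι ℝ E) {G : E → E →L[ℝ] E →L[ℝ] ℝ} {x : E}
    (hi : (G x).IsInvertible) (hs : ∀ v w, G x v w = G x w v) {lam : ℝ} (hlam : 0 < lam)
    (hpos : ∀ v : E, lam * ‖v‖ ^ 2 ≤ G x v v) (a c : ι) :
    |ginv G b x a c| ≤ ‖coordCLM b a‖ * ‖coordCLM b c‖ * (finrank ℝ E / lam) := by
  have hposv : ∀ v, v ≠ 0 → 0 < G x v v := fun v hv ↦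
    lt_of_lt_of_le (mul_pos hlam (by positivity)) (hpos v)
  obtain ⟨e, he⟩ := exists_orthonormal_basis hs hposv
  rw [ginv_eq_sum_coord_frame b e he hi hs]
  have hek : ∀ k, ‖e k‖ ^ 2 ≤ 1 / lam := fun k ↦ by
    rw [le_div_iff₀ hlam, mul_comm]
    have h := hpos (e k)
    rw [he k k, if_pos rfl] at h
    exact h
  calc |∑ k, b.coord a (e k) * b.coord c (e k)| ≤ ∑ k, |b.coord a (e k) * b.coord c (e k)| :=
        Finset.abs_sum_le_sum_abs _ _
    _ ≤ ∑ _k : Fin (finrank ℝ E), ‖coordCLM b a‖ * ‖coordCLM b c‖ * (1 / lam) := by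
        refine Finset.sum_le_sum fun k _ ↦ ?_
        rw [abs_mul]
        have h1 : |b.coord a (e k)| ≤ ‖coordCLM b a‖ * ‖e k‖ := by
          rw [← Real.norm_eq_abs, ← coordCLM_apply]; exact (coordCLM b a).le_opNorm _
        have h2 : |b.coord c (e k)| ≤ ‖coordCLM b c‖ * ‖e k‖ := by
          rw [← Real.norm_eq_abs, ← coordCLM_apply]; exact (coordCLM b c).le_opNorm _
        calc |b.coord a (e k)| * |b.coord c (e k)| ≤ (‖coordCLM b a‖ * ‖e k‖) * (‖coordCLM b c‖ * ‖e k‖) :=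
              mul_le_mul h1 h2 (abs_nonneg _) (by positivity)
          _ = ‖coordCLM b a‖ * ‖coordCLM b c‖ * ‖e k‖ ^ 2 := by ring
          _ ≤ _ := mul_le_mul_of_nonneg_left (hek k) (by positivity)
    _ = _ := by rw [Finset.sum_const, Finset.card_univ, Fintype.card_fin, nsmul_eq_mul]; ring

end Ginv

/-! ### Logarithmic bounds for `Γ` and `∂Γ` along the coordinate Ricci flow -/

section LogBounds

variable {E : Type u} [NormedAddCommGroup E] [NormedSpace ℝ E] [FiniteDimensional ℝ E]
  [CompleteSpace E] {ι : Type*} [Fintype ι] (b : Basis ι ℝ E)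
  {G : ℝ → E → E →L[ℝ] E →L[ℝ] ℝ} {V K : Set E} {t₀ T : ℝ}
  (hG : IsMetricFamilyOn G (Ico t₀ T) V)
  (hfl : ∀ s ∈ Ico t₀ T, ∀ y ∈ V, tDeriv G (Ico t₀ T) s y = (-2 : ℝ) • ricAt (G s) y)
  (hK : IsCompact K) (hKV : K ⊆ V) (ht₀ : t₀ < T)
  {Cg : ℝ} (hginv : ∀ t ∈ Ico t₀ T, ∀ y ∈ K, ∀ a c, |ginv (G t) b y a c| ≤ Cg / (T - t))
  {C₁ : ℝ} (hR1 : ∀ t ∈ Ico t₀ T, ∀ y ∈ K, ∀ J : Fin 1 ⊕ Fin 2 → ι,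
    |tcovIter (G t) b 1 (ric2 (G t) b) y J| ≤ C₁)

include hginv hR1 in
omit [CompleteSpace E] in
/-- **The time derivative of `Γ` is `O((T−t)⁻¹)`**: with `|g^{ml}| ≤ C_g/(T−t)` and
`|(∇Ric)_J| ≤ C₁` on `K`, Topping's Prop. 2.3.1
`∂ₜΓ^m_{ji} = −Σ_l g^{ml}((∇_jRic)_{il} + (∇_iRic)_{jl} − (∇_lRic)_{ji})` gives
`|∂ₜΓ^m_{ji}| ≤ 3 n |C_g| |C₁| /(T−t)`. [cite: Topping2006, Prop. 2.3.1] -/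
theorem abs_chrDot_le {t : ℝ} (ht : t ∈ Ico t₀ T) {y : E} (hy : y ∈ K) (j i m : ι) :
    |-∑ d, ginv (G t) b y m d * (tcov (G t) b (ric2 (G t) b) y (ocons j (pair i d))
        + tcov (G t) b (ric2 (G t) b) y (ocons i (pair j d))
        - tcov (G t) b (ric2 (G t) b) y (ocons d (pair j i)))| ≤
      3 * Fintype.card ι * |Cg| * |C₁| / (T - t) := by
  have hTt : 0 < T - t := sub_pos.2 ht.2
  have hg : ∀ a c, |ginv (G t) b y a c| ≤ |Cg| / (T - t) := fun a c ↦
    (hginv t ht y hy a c).trans (div_le_div_of_nonneg_right (le_abs_self _) hTt.le)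
  have hT : ∀ J : Option (Fin 2) → ι, |tcov (G t) b (ric2 (G t) b) y J| ≤ |C₁| := fun J ↦ by
    rw [tcov_eq_tcovIter_one b]
    exact (hR1 t ht y hy _).trans (le_abs_self _)
  rw [abs_neg]
  calc _ ≤ ∑ d, |ginv (G t) b y m d * (tcov (G t) b (ric2 (G t) b) y (ocons j (pair i d))
          + tcov (G t) b (ric2 (G t) b) y (ocons i (pair j d))
          - tcov (G t) b (ric2 (G t) b) y (ocons d (pair j i)))| := Finset.abs_sum_le_sum_abs _ _
    _ ≤ ∑ _d : ι, |Cg| / (T - t) * (3 * |C₁|) := by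
        refine Finset.sum_le_sum fun d _ ↦ ?_
        rw [abs_mul]
        refine mul_le_mul (hg m d) ?_ (abs_nonneg _) (div_nonneg (abs_nonneg _) hTt.le)
        calc _ ≤ |tcov (G t) b (ric2 (G t) b) y (ocons j (pair i d)) + tcov (G t) b (ric2 (G t) b) y (ocons i (pair j d))|
              + |tcov (G t) b (ric2 (G t) b) y (ocons d (pair j i))| := abs_sub _ _
          _ ≤ (|C₁| + |C₁|) + |C₁| := add_le_add ((abs_add_le _ _).trans (add_le_add (hT _) (hT _))) (hT _)
          _ = 3 * |C₁| := by ring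
    _ = 3 * Fintype.card ι * |Cg| * |C₁| / (T - t) := by
        rw [Finset.sum_const, Finset.card_univ, nsmul_eq_mul]; ring

include hG hfl hK hKV ht₀ hginv hR1 in
/-- **Logarithmic growth of the Christoffel symbols**: on `K × [t₀, T)`,
`|Γ^m_{ji}(y, t)| ≤ A₀ (1 + log((T−t₀)/(T−t)))` — time integration of `|∂ₜΓ| ≤ c/(T−t)` from the
compact slice `t = t₀` (`abs_le_of_deriv_boundary` with the boundary function
`c log((T−t₀)/(T−s))`). [cite: Hamilton1982, §14, Lemma 14.2 ff.] [cite: Topping2006, Prop. 2.3.1] -/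
theorem abs_chrCoef_le_log :
    ∃ A₀ : ℝ, 0 ≤ A₀ ∧ ∀ t ∈ Ico t₀ T, ∀ y ∈ K, ∀ j i m : ι,
      |chrCoef (G t) b y j i m| ≤ A₀ * (1 + Real.log ((T - t₀) / (T - t))) := by
  have hV : IsOpen V := hG.isOpen ⟨le_rfl, ht₀⟩
  have ht₀' : t₀ ∈ Ico t₀ T := ⟨le_rfl, ht₀⟩
  -- the bound at `t₀` on the compact `K`
  have hcont : ContinuousOn (fun y ↦ ∑ j, ∑ i, ∑ m, |chrCoef (G t₀) b y j i m|) K := by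
    refine continuousOn_finsetSum _ fun j _ ↦ continuousOn_finsetSum _ fun i _ ↦
      continuousOn_finsetSum _ fun m _ ↦ ?_
    exact (((hG.isMetricOn t₀ ht₀').contDiffOn_chrCoef b j i m).continuousOn.mono hKV).abs
  obtain ⟨B₀, hB₀⟩ := hK.exists_bound_of_continuousOn hcont
  have hB₀' : ∀ y ∈ K, ∀ j i m, |chrCoef (G t₀) b y j i m| ≤ B₀ := by
    intro y hy j i m
    have h := hB₀ y hy
    rw [Real.norm_eq_abs, abs_of_nonneg (Finset.sum_nonneg fun _ _ ↦ Finset.sum_nonneg fun _ _ ↦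
      Finset.sum_nonneg fun _ _ ↦ abs_nonneg _)] at h
    refine le_trans ?_ h
    refine le_trans ?_ (Finset.single_le_sum (f := fun j ↦ ∑ i, ∑ m, |chrCoef (G t₀) b y j i m|)
      (fun _ _ ↦ Finset.sum_nonneg fun _ _ ↦ Finset.sum_nonneg fun _ _ ↦ abs_nonneg _) (Finset.mem_univ j))
    refine le_trans ?_ (Finset.single_le_sum (f := fun i ↦ ∑ m, |chrCoef (G t₀) b y j i m|)
      (fun _ _ ↦ Finset.sum_nonneg fun _ _ ↦ abs_nonneg _) (Finset.mem_univ i))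
    exact Finset.single_le_sum (f := fun m ↦ |chrCoef (G t₀) b y j i m|) (fun _ _ ↦ abs_nonneg _)
      (Finset.mem_univ m)
  -- the constant of the derivative bound
  set c : ℝ := 3 * Fintype.card ι * |Cg| * |C₁| with hc
  have hc0 : 0 ≤ c := by positivity
  have hB₀nn : 0 ≤ max B₀ c := hc0.trans (le_max_right _ _)
  refine ⟨max B₀ c, hB₀nn, fun t ht y hy j i m ↦ ?_⟩
  obtain ⟨hlog, hlog0⟩ := log_ratio_eq ht
  -- comparison on `[t₀, T)`
  have hder : ∀ s ∈ Ico t₀ T, HasDerivWithinAt (fun s ↦ chrCoef (G s) b y j i m)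
      (-∑ d, ginv (G s) b y m d * (tcov (G s) b (ric2 (G s) b) y (ocons j (pair i d))
        + tcov (G s) b (ric2 (G s) b) y (ocons i (pair j d))
        - tcov (G s) b (ric2 (G s) b) y (ocons d (pair j i)))) (Ico t₀ T) s :=
    fun s hs ↦ hG.hasDerivWithinAt_chrCoef_of_flow' b hfl hs (hKV hy) j i m
  have hBc : ContinuousOn (fun s ↦ c * -Real.log (T - s)) (Ico t₀ T) := by
    have h1 : ContinuousOn (fun s : ℝ ↦ Real.log (T - s)) (Ico t₀ T) :=
      (continuousOn_const.sub continuousOn_id).log fun s hs ↦ (sub_pos.2 hs.2).ne'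
    exact continuousOn_const.mul h1.neg
  have key := abs_le_of_deriv_boundary (B' := fun s ↦ c * (1 / (T - s))) hder hBc
    (fun s hs ↦ (hasDerivWithinAt_log_sub hs.2).const_mul c)
    (fun s hs ↦ by
      have h := abs_chrDot_le b hginv hR1 hs hy j i m
      rw [← hc, div_eq_mul_one_div] at h
      exact h) t ht
  -- assemble
  have hBt : c * -Real.log (T - t) - c * -Real.log (T - t₀) = c * Real.log ((T - t₀) / (T - t)) := by
    rw [hlog]; ring
  rw [hBt] at key
  calc |chrCoef (G t) b y j i m| ≤ |chrCoef (G t₀) b y j i m| + c * Real.log ((T - t₀) / (T - t)) := key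
    _ ≤ max B₀ c + max B₀ c * Real.log ((T - t₀) / (T - t)) :=
        add_le_add ((hB₀' y hy j i m).trans (le_max_left _ _))
          (mul_le_mul_of_nonneg_right (le_max_right _ _) hlog0)
    _ = max B₀ c * (1 + Real.log ((T - t₀) / (T - t))) := by ring

/-- **HELPER `helper_abs_chrCoef_le_log`** — the registered form of `abs_chrCoef_le_log`
(logarithmic growth of the Christoffel symbols of a coordinate Ricci flow with scaled bounds).
[cite: Hamilton1982, §14, Lemma 14.2 ff.] [cite: Topping2006, Prop. 2.3.1] -/
theorem helper_abs_chrCoef_le_log : ∀ {E : Type u} [NormedAddCommGroup E] [NormedSpace ℝ E] [FiniteDimensional ℝ E] [CompleteSpace E] {ι : Type*} [Fintype ι] (b : Module.Basis ι ℝ E) {G : ℝ → E → E →L[ℝ] E →L[ℝ] ℝ} {V K : Set E} {t₀ T : ℝ}, MetricCoord.IsMetricFamilyOn G (Ico t₀ T) V → (∀ s ∈ Ico t₀ T, ∀ y ∈ V, MetricCoord.tDeriv G (Ico t₀ T) s y = (-2 : ℝ) • MetricCoord.ricAt (G s) y) → IsCompact K → K ⊆ V → t₀ < T → ∀ {Cg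 : ℝ}, (∀ t ∈ Ico t₀ T, ∀ y ∈ K, ∀ a c, |MetricCoord.ginv (G t) b y a c| ≤ Cg / (T - t)) → ∀ {C₁ : ℝ}, (∀ t ∈ Ico t₀ T, ∀ y ∈ K, ∀ J : Fin 1 ⊕ Fin 2 → ι, |MetricCoord.tcovIter (G t) b 1 (MetricCoord.ric2 (G t) b) y J| ≤ C₁) → ∃ A₀ : ℝ, 0 ≤ A₀ ∧ ∀ t ∈ Ico t₀ T, ∀ y ∈ K, ∀ j i m : ι, |MetricCoord.chrCoef (G t) b y j i m| ≤ A₀ * (1 + Real.log ((T - t₀) / (T - t))) := by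
  intro E _ _ _ _ ι _ b G V K t₀ T hG hfl hK hKV ht₀ Cg hginv C₁ hR1
  exact abs_chrCoef_le_log b hG hfl hK hKV ht₀ hginv hR1

end LogBounds

end Summit.SmoothPoincare4.SmoothPoincare4.Theorems.MargerinRails

end
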